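import Literature.NumberTheory.IwasawaTheory.NarrowFukudaRankMonotone
import Literature.NumberTheory.NumberFields.NarrowClassGroupRingEquiv
import HarnessLib

/-!
# The narrow `p`-rank exceeds the wide one by at most the narrow defect — and the completeness of the narrow rank certificate:
# «`μ₂ = 0` ∧ bounded narrow defect» (Kida-lite's hypotheses) ⟺ «two consecutive layers above `n₀` have the same narrow `2`-rank»

Topic `NumberTheory/IwasawaTheory` (namespace = path; §1 extends `Literature.NumberTheory.NumberFields`, the namespace of `NarrowClassGroupCounting`). THEOREM-ONLY
file (no definition, no named fact, no `sorry`), written by the prover seat `cruxlead-stmt-BirchSwinnertonDyer-19573-w2` GEN 11 (cell `bsd-2adic`; `--supports`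
stmt-BirchSwinnertonDyer-19573; closes nothing).  Sequel of `NarrowClassGroupCounting` (GEN 9: `[Cl : Cl^p] ∣ [Cl⁺ : (Cl⁺)^p]`, `h⁺/h ∣ [Cl⁺ : (Cl⁺)²]`) and
`NarrowFukudaRankMonotone` (this seat: bounded narrow ranks ⟺ a stabilising pair).

* §1 **`index_range_pow_narrowClassGroup_dvd_classGroup_mul_relIndex`** — `[Cl⁺_K : (Cl⁺_K)^p] ∣ [Cl_K : Cl_K^p] · [P_K : P_K⁺]` for every number field `K` and every
  `p`: inside `I_K`, `[Cl⁺ : (Cl⁺)^p] = [I : P⁺I^p]` (GEN 9's `index_range_pow_narrowClassGroup_eq_index_sup`), `[Cl : Cl^p] = [I : PI^p]` (`ClassGroup ≅ I/P`), and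
  `[PI^p : P⁺I^p] = [P : P ∩ P⁺I^p] ∣ [P : P⁺] = h⁺/h` (Fröhlich–Taylor (1.8)–(1.9)); with GEN 9's converse divisibility this pins the narrow `p`-rank between the wide
  one and the wide one plus the narrow defect: **`padicValNat_index_range_pow_narrowClassGroup_le`** (`ord_p [Cl⁺:(Cl⁺)^p] ≤ ord_p [Cl:Cl^p] + (ord_p h⁺ − ord_p h)`).
* §2 (`p = 2`, `ℤ₂`-towers) **`NarrowFukuda.exists_forall_padicValNat_le_of_classicalMuVanishes_of_narrowDefect_le`** — Iwasawa's `μ₂ = 0` (`⟺` bounded wide `2`-ranks,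
  tree `classicalMuVanishes_iff_exists_forall_classGroupPRank_le`) and a bounded narrow defect `ord₂ h⁺(K_m) ≤ ord₂ h(K_m) + D` give BOUNDED NARROW `2`-RANKS; ★
  **`NarrowFukuda.classicalMuVanishes_and_narrowDefect_le_iff_exists_succ_eq`** — for a `ℤ₂`-extension with Fukuda index `n₀`:
  «(a) `μ₂ = 0` ∧ (b) `∃ D ∀ m, ord₂ h⁺(K_m) ≤ ord₂ h(K_m) + D`» ⟺ «`∃ m ≥ n₀`, `[Cl⁺(K_{m+1}) : (Cl⁺)²] = [Cl⁺(K_m) : (Cl⁺)²]`» (⟸ is NARROW FUKUDA, GEN 9's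
  `classicalMuVanishes_and_exists_narrowDefect_le_of_succ_eq`; ⟹ is §1 + monotonicity).  So the Kida-lite hypotheses of the `0 < Δ` doors
  (`NarrowMu.conjA_two_of_narrowMu_pointField`) and the rung hypotheses of this seat's doors (`NarrowRankRung.…_layer_succ_eq`) are EQUIVALENT field by field.

Nothing is asserted about any field.  BSD is not proved by any of this.

References: [FrohlichTaylor1990] Ch. V §1 (1.8)–(1.13), pp. 163–164; [NeukirchANT1999] Ch. VI §1 Def. (1.7), Prop. (1.9); [Fukuda1994] Thm. 1 (2), p. 264;
[Washington1997] §13.3 Prop. 13.22–13.23; [Kida1982JFields] (μ-part; shape); [GreenbergLNM1716] §5, p. 122.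
-/

set_option autoImplicit false

noncomputable section

open scoped NumberField nonZeroDivisors
open NumberField IsDedekindDomain

/-! ## §1 `[Cl⁺ : (Cl⁺)^p] ∣ [Cl : Cl^p] · (h⁺/h)` -/

namespace Literature.NumberTheory.NumberFields

open Literature.NumberTheory.GaloisRepresentations

variable {K : Type} [Field K] [NumberField K]

/-- Transport of `[A : A^p]` along a group isomorphism. [folklore] -/
private theorem index_range_pow_eq_of_mulEquiv {A B : Type*} [CommGroup A] [CommGroup B] (e : A ≃* B) (p : ℕ) :
    (powMonoidHom (α := B) p).range.index = (powMonoidHom (α := A) p).range.index := by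
  have hmap : (powMonoidHom (α := B) p).range = ((powMonoidHom (α := A) p).range).map (e : A →* B) := by
    ext y
    constructor
    · rintro ⟨b, rfl⟩
      obtain ⟨a, rfl⟩ := e.surjective b
      exact ⟨a ^ p, ⟨a, rfl⟩, by rw [MonoidHom.coe_coe, map_pow, powMonoidHom_apply]⟩
    · rintro ⟨_, ⟨a, rfl⟩, rfl⟩
      exact ⟨e a, by rw [powMonoidHom_apply, powMonoidHom_apply, MonoidHom.coe_coe, map_pow]⟩
  rw [hmap, Subgroup.index_map_equiv]

/-- **`[Cl_K : Cl_K^p] = [I_K : P_K · I_K^p]`** (Mathlib's class group is `I_K/P_K`, `ClassGroup.equiv`). [cite: FrohlichTaylor1990, Ch. V §1 (C_N = I_N/P_N), p. 163] -/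
theorem index_range_pow_classGroup_eq_index_sup (p : ℕ) :
    (powMonoidHom p : ClassGroup (𝓞 K) →* ClassGroup (𝓞 K)).range.index =
      ((toPrincipalIdeal (𝓞 K) K).range ⊔ (powMonoidHom (α := (FractionalIdeal (𝓞 K)⁰ K)ˣ) p).range).index := by
  rw [← index_range_pow_quotient_eq_index_sup]
  exact (index_range_pow_eq_of_mulEquiv (ClassGroup.equiv (R := 𝓞 K) K) p).symm

/-- ★ **`[Cl⁺_K : (Cl⁺_K)^p] ∣ [Cl_K : Cl_K^p] · [P_K : P_K⁺]`** for every number field `K` and every `p` (`[P_K : P_K⁺] = h⁺_K/h_K`, Fröhlich–Taylor (1.8)–(1.9)):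
`[I : P⁺I^p] = [I : PI^p]·[PI^p : P⁺I^p]` and `[PI^p : P⁺I^p] = [P : P ∩ P⁺I^p] ∣ [P : P⁺]`.  With GEN 9's `[Cl : Cl^p] ∣ [Cl⁺ : (Cl⁺)^p]` this pins the narrow `p`-rank:
`rank_p Cl ≤ rank_p Cl⁺ ≤ rank_p Cl + ord_p (h⁺/h)` (so they agree for odd `p`). [cite: FrohlichTaylor1990, Ch. V §1 (1.8)–(1.9), p. 163] [cite: NeukirchANT1999, Ch. VI §1 Def. (1.7), Prop. (1.9)] -/
theorem index_range_pow_narrowClassGroup_dvd_classGroup_mul_relIndex (p : ℕ) :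
    (powMonoidHom (α := NarrowClassGroup K) p).range.index ∣
      (powMonoidHom p : ClassGroup (𝓞 K) →* ClassGroup (𝓞 K)).range.index *
        (totPosPrincipalIdeals K).relIndex (toPrincipalIdeal (𝓞 K) K).range := by
  rw [index_range_pow_narrowClassGroup_eq_index_sup, index_range_pow_classGroup_eq_index_sup]
  set P : Subgroup (FractionalIdeal (𝓞 K)⁰ K)ˣ := (toPrincipalIdeal (𝓞 K) K).range with hP
  set Pp : Subgroup (FractionalIdeal (𝓞 K)⁰ K)ˣ := totPosPrincipalIdeals K with hPp
  set Ip : Subgroup (FractionalIdeal (𝓞 K)⁰ K)ˣ := (powMonoidHom (α := (FractionalIdeal (𝓞 K)⁰ K)ˣ) p).range with hIp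
  have hle : Pp ≤ P := totPosPrincipalIdeals_le_range K
  have hNle : Pp ⊔ Ip ≤ P ⊔ Ip := sup_le_sup_right hle Ip
  -- `[PI^p : P⁺I^p] = [P : P ∩ P⁺I^p] ∣ [P : P⁺]`
  have hsup : P ⊔ Ip = (Pp ⊔ Ip) ⊔ P :=
    le_antisymm (sup_le le_sup_right (le_sup_of_le_left le_sup_right)) (sup_le hNle le_sup_left)
  have h : (Pp ⊔ Ip).relIndex (P ⊔ Ip) ∣ Pp.relIndex P := by
    rw [hsup, Subgroup.relIndex_sup_left]
    exact Subgroup.relIndex_dvd_of_le_left P (le_sup_left : Pp ≤ Pp ⊔ Ip)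
  rw [← Subgroup.relIndex_mul_index hNle]
  calc (Pp ⊔ Ip).relIndex (P ⊔ Ip) * (P ⊔ Ip).index ∣ Pp.relIndex P * (P ⊔ Ip).index := mul_dvd_mul_right h _
    _ = (P ⊔ Ip).index * Pp.relIndex P := mul_comm _ _

/-- **`ord_p [Cl⁺_K : (Cl⁺_K)^p] ≤ ord_p [Cl_K : Cl_K^p] + (ord_p h⁺_K − ord_p h_K)`** (`h⁺ = h · [P : P⁺]`). [cite: FrohlichTaylor1990, Ch. V §1 (1.8)–(1.9), p. 163] -/
theorem padicValNat_index_range_pow_narrowClassGroup_le (p : ℕ) [hp : Fact p.Prime] :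
    padicValNat p (powMonoidHom (α := NarrowClassGroup K) p).range.index ≤
      padicValNat p (powMonoidHom p : ClassGroup (𝓞 K) →* ClassGroup (𝓞 K)).range.index +
        (padicValNat p (narrowClassNumber K) - padicValNat p (classNumber K)) := by
  classical
  haveI : Finite (NarrowClassGroup K) := finite_rayClassGroup top_ne_bot
  have hrel0 : (totPosPrincipalIdeals K).relIndex (toPrincipalIdeal (𝓞 K) K).range ≠ 0 := by
    intro h0
    have h := narrowClassNumber_eq_classNumber_mul_relIndex K
    rw [h0, mul_zero] at h
    exact (Nat.card_pos (α := NarrowClassGroup K)).ne' h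
  have hidxC0 : (powMonoidHom p : ClassGroup (𝓞 K) →* ClassGroup (𝓞 K)).range.index ≠ 0 := Subgroup.index_ne_zero_of_finite
  have hdefect : padicValNat p (narrowClassNumber K) - padicValNat p (classNumber K) =
      padicValNat p ((totPosPrincipalIdeals K).relIndex (toPrincipalIdeal (𝓞 K) K).range) := by
    rw [narrowClassNumber_eq_classNumber_mul_relIndex, padicValNat.mul (classNumber_pos K).ne' hrel0, Nat.add_sub_cancel_left]
  rw [hdefect, ← padicValNat.mul hidxC0 hrel0]
  exact (padicValNat_dvd_iff_le (mul_ne_zero hidxC0 hrel0)).1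
    (pow_padicValNat_dvd.trans (index_range_pow_narrowClassGroup_dvd_classGroup_mul_relIndex p))

end Literature.NumberTheory.NumberFields

/-! ## §2 Kida-lite's hypotheses (a) ∧ (b) ⟺ a stabilising pair of narrow `2`-ranks -/

namespace Literature.NumberTheory.IwasawaTheory

open Literature.NumberTheory.EllipticCurves Literature.NumberTheory.NumberFields Literature.NumberTheory.GaloisRepresentations

variable {K : Type} [Field K] [NumberField K]

/-- **`μ₂ = 0` and a bounded narrow defect give bounded narrow `2`-ranks** along a `ℤ₂`-extension: `rank₂ Cl⁺(K_m) ≤ rank₂ Cl(K_m) + (ord₂ h⁺(K_m) − ord₂ h(K_m))`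
(§1), `rank₂ Cl(K_m)` bounded iff `μ = 0` (tree `classicalMuVanishes_iff_exists_forall_classGroupPRank_le`). [cite: Washington1997, §13.3 Prop. 13.23]
[cite: FrohlichTaylor1990, Ch. V §1 (1.8)–(1.9), p. 163] -/
theorem NarrowFukuda.exists_forall_padicValNat_le_of_classicalMuVanishes_of_narrowDefect_le (κ : ZpExtension K 2)
    (hμ : ClassicalMuVanishes κ) {D : ℕ}
    (hδ : ∀ m : ℕ, ∀ [NumberField (κ.layer m)], padicValNat 2 (narrowClassNumber (κ.layer m)) ≤ padicValNat 2 (classNumber (κ.layer m)) + D) :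
    ∃ B : ℕ, ∀ m : ℕ, ∀ [NumberField (κ.layer m)], padicValNat 2 (powMonoidHom (α := NarrowClassGroup (κ.layer m)) 2).range.index ≤ B := by
  haveI : Fact (Nat.Prime 2) := ⟨Nat.prime_two⟩
  obtain ⟨B, hB⟩ := (classicalMuVanishes_iff_exists_forall_classGroupPRank_le κ).mp hμ
  refine ⟨B + D, fun m _ => ?_⟩
  have h1 := padicValNat_index_range_pow_narrowClassGroup_le (K := ↥(κ.layer m)) 2
  have h2 : padicValNat 2 (powMonoidHom 2 : ClassGroup (𝓞 (κ.layer m)) →* ClassGroup (𝓞 (κ.layer m))).range.index = classGroupPRank κ m := by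
    rw [classGroupPRank_def, Subgroup.index_eq_card]
  have h3 := hB m
  have h4 := hδ m
  omega

/-- ★ **KIDA-LITE'S HYPOTHESES ⟺ A STABILISING PAIR OF NARROW `2`-RANKS.**  For a `ℤ₂`-extension `κ` of a number field with Fukuda index `n₀`: «(a) `μ₂ = 0`
(growth form) ∧ (b) `∃ D`, `ord₂ h⁺(K_m) ≤ ord₂ h(K_m) + D` for every layer (any `NumberField` instance)» holds iff «for some `m ≥ n₀`,
`[Cl⁺(K_{m+1}) : Cl⁺(K_{m+1})²] = [Cl⁺(K_m) : Cl⁺(K_m)²]` (any `NumberField` instances)».  ⟸: NARROW FUKUDA (GEN 9,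
`NarrowFukuda.classicalMuVanishes_and_exists_narrowDefect_le_of_succ_eq`).  ⟹: (a) ∧ (b) bound the narrow `2`-ranks (previous theorem), and bounded narrow ranks above
the index stabilise at some consecutive pair (`NarrowFukuda.exists_succ_eq_of_forall_padicValNat_le`).  Hence the rung doors and the Kida-lite doors of the cell consume
EQUIVALENT data, field by field. [cite: Fukuda1994, Thm. 1 (2), p. 264] [cite: Washington1997, §13.3 Prop. 13.22–13.23] [cite: Kida1982JFields, main theorem (μ-part; shape only)] -/
theorem NarrowFukuda.classicalMuVanishes_and_narrowDefect_le_iff_exists_succ_eq (κ : ZpExtension K 2) {n₀ : ℕ}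
    (hκ : TotallyRamifiedFrom κ n₀) :
    (ClassicalMuVanishes κ ∧ ∃ D : ℕ, ∀ m : ℕ, ∀ [NumberField (κ.layer m)],
        padicValNat 2 (narrowClassNumber (κ.layer m)) ≤ padicValNat 2 (classNumber (κ.layer m)) + D) ↔
      ∃ m, n₀ ≤ m ∧ ∀ [NumberField (κ.layer m)] [NumberField (κ.layer (m + 1))],
        (powMonoidHom (α := NarrowClassGroup (κ.layer (m + 1))) 2).range.index =
          (powMonoidHom (α := NarrowClassGroup (κ.layer m)) 2).range.index := by
  haveI : Fact (Nat.Prime 2) := ⟨Nat.prime_two⟩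
  constructor
  · rintro ⟨hμ, D, hδ⟩
    obtain ⟨B, hB⟩ := NarrowFukuda.exists_forall_padicValNat_le_of_classicalMuVanishes_of_narrowDefect_le κ hμ hδ
    obtain ⟨m, hm, -, heq⟩ := NarrowFukuda.exists_succ_eq_of_forall_padicValNat_le κ hκ hB
    exact ⟨m, hm, heq⟩
  · rintro ⟨m, hm, heq⟩
    haveI : FiniteDimensional K (κ.layer m) := κ.finiteDimensional_layer_holds m
    haveI : FiniteDimensional K (κ.layer (m + 1)) := κ.finiteDimensional_layer_holds (m + 1)
    haveI : NumberField (κ.layer m) := NumberField.of_module_finite K _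
    haveI : NumberField (κ.layer (m + 1)) := NumberField.of_module_finite K _
    obtain ⟨hμ, D, hD⟩ := NarrowFukuda.classicalMuVanishes_and_exists_narrowDefect_le_of_succ_eq κ hκ hm heq
    exact ⟨hμ, D, hD⟩

end Literature.NumberTheory.IwasawaTheory

end
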